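import Summits.QuantumFields.YangMills.Theorems.AlphaInputsT3ACLoc59RowsOfGraphPair
import HarnessLib

/-!
# `AlphaInputsT3ACCumulantLeavesOfLoc59Rows` — THE (D←) DOOR OF THE (R2′) RE-CUT: «the two (59)-localisation rows `hloc58` ∧ `hlocLow` + the (3.24) rows ⟹ the C3∕C4 step leaves
# `Cumulant58` ∕ `CumulantLower` AT THE RECORD CONSTANTS» — the kernel certificate that the re-cut rows SUFFICE for everything the lane reads from (α) rows #14∕#15
# (cell `ym3-torus`, ★★OWNER g35 word 2026-08-30 13:4xZ «GO (D←)»; companion of ✓`AlphaInputsT3ACLoc59RowsOfGraphPair` ((D→), «loses nothing»); seat `ym-line-cst-p1` g37, free hand;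
# `--supports stmt-QuantumFields-19936 --as helper`; CREDITS NOTHING)

THE POINT (LOCATE #60 §3).  C3 = ✓`AlphaAdaptersAC.cumulant58_piecesAC` and C4 = ✓`cumulantLower_piecesAC` (the fields `cumulant58`∕`cumulantLower` of `Thm2AC`'s step residuals) are today fed by rows #14
`hact` + #15 `hG` + (25); inside they are ✓`Cumulant324.cumulant58_of_eq324` ∕ `cumulantLower_of_eq324` applied to a DERIVED `hloc`.  Here the SAME (3.24) bookkeeping is fed with the re-cut rows
DIRECTLY — no graph carrier `Gt`, no `hact`, no `hG`, no (25):
* §1 ★★★ `cumulant58_piecesAC_of_hloc58` — `(hμ hboxm hbox hVm hVB h324a h324c)` + `hloc58` ⟹ `Cumulant58 (piecesAC 𝔠.lane X 𝔖 k) 𝔠.lane.sc.Cz 𝔠.lane.sc.C₁` (C3 at the record constants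
  `Cz = C25·K₀(32,6)`, `C₁ = 0 + C25·K₀·e^{−R₁} + (Ca + 0 + Cc)` — `rfl` at `𝔠.lane`), with the bookkeeping of ✓`Cumulant324.cumulant58_of_eq324` inlined (as ✓`Cumulant59.cumulant58_of_eq324_bound25` does): `logFl = log ∫_{box} e^{𝒱} dμ` by `rfl`, (3.24) by ✓`eq324_indicator_of_measurableSet` + ✓`B1Eq324CumulantTaylor.abs_log_sub_le_of_eq324`
  (re-expansion input (b) vanishes: `(𝔖 k).cum := truncExp …`), `rem` in the normalised unit by ✓`norm_rem_eq`.
* §2 ★★★ `cumulantLower_piecesAC_of_hlocLow` — the lower twin at the trivial history ⟹ `CumulantLower (piecesAC 𝔠.lane X 𝔖 k) 𝔠.lane.sc.C₁'` (C4; `C₁' = C₁`).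
* §3 ★★ `cumulant58_piecesAC_via_hloc58` ∕ `cumulantLower_piecesAC_via_hlocLow` — THE ROUND TRIP (D→) ∘ (D←): today's rows #14 `hact` + #15 `hG` + (25) `h25` give C3 ∕ C4 back
  THROUGH the re-cut rows (✓`AlphaV3Loc59RowsOfGraphPair.hloc58_of_hact_hG` ∕ `hlocLow_of_hact_hG`, then §1 ∕ §2) — the kernel certificate that the (R2′) re-cut
  `{hact, hG} ↦ {hloc58, hlocLow}` is SUFFICIENT for everything the lane reads from rows #14∕#15 (no `hCz`∕`hC₁` equations: `rfl` at `𝔠.lane`; no run slot but `k + 1 ≤ K` in §3).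
HONEST SCOPE: a door over landed carriers; (α) data rows 0∕23 unchanged; the (59) localisation estimate and [B1] (3.24)'s inputs are HYPOTHESES; nothing of (O‴χₛ), `HistoryTailL` (19936), EX,
`YM3TorusSU2` (R3 — SU(2) YM₃ on T³, a RECORD rung: NOT d = 4, NOT infinite volume, NOT a mass gap, NOT Clay) is proved; the Yang–Mills mass gap is NOT proved.

References: T. Bałaban, Commun. Math. Phys. **102** (1985) 255–275 [Balaban1985UV3] ((24) p.262, (58)–(59) p.270, (37) p.265, p.272); Commun. Math. Phys. **85** (1982) 603–636
[Balaban1982Higgs1] ((3.24) p.616).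
-/

set_option autoImplicit false

noncomputable section

namespace Summit.QuantumFields.YangMills.Theorems.AlphaV3CumulantLeavesOfLoc59Rows

open scoped BigOperators Nat
open MeasureTheory Metric
open Literature.MathematicalPhysics.QuantumFieldTheory.Balaban1983to89
open Literature.MathematicalPhysics.QuantumFieldTheory.Balaban1983to89.B10
open Literature.MathematicalPhysics.QuantumFieldTheory.Balaban1983to89.B10SectAGathering (Cumulant58 CumulantLower)
open Literature.MathematicalPhysics.QuantumFieldTheory.Balaban1983to89.B10Eq24Cumulant (chiMeasure truncExp)
open Literature.MathematicalPhysics.QuantumFieldTheory.Balaban1983to89.B12TreeDecay (K₀)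
open Literature.MathematicalPhysics.QuantumFieldTheory.Balaban1983to89.TreeLengthTorus (tsys)
open Literature.MathematicalPhysics.QuantumFieldTheory.Balaban1985CMP102
open Literature.MathematicalPhysics.QuantumFieldTheory.Balaban1985CMP102.Setting
open Literature.MathematicalPhysics.QuantumFieldTheory.Balaban1985CMP102.Binders (GraphRep23AsCited)
open Summit.QuantumFields.Balaban3D.Carriers
open Summit.QuantumFields.Balaban3D.Proofs
open Summit.QuantumFields.Balaban3D.Proofs.ScalesArithmetic (norm_rem_eq)
open Summit.QuantumFields.Balaban3D.Proofs.Primitives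
open Summit.QuantumFields.Balaban3D.Proofs.TowerAC
open Summit.QuantumFields.Balaban3D.Proofs.SeriesAC
open Summit.QuantumFields.Balaban3D.Proofs.StandardAC
open Summit.QuantumFields.Balaban3D.Proofs.InputsAC
open Summit.QuantumFields.Balaban3D.Proofs.GroupModelLieC (lieC)

variable {L : ℕ} {S : Scales L} {G : Type} [GaugeGroup G] [MeasurableSpace G] [HaarData G] (𝔊 : GroupModel G) (𝔠 : AlphaConsts L 𝔊.N)
  (X : ExternalInputsAC S G) (𝔖 : ∀ k, StepSeries S G ↥(lieC 𝔊) (nblkOf S 𝔠.lane.carrier k) k) (k : ℕ)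

/-! ## §1 C3 from `hloc58` + the (3.24) rows -/

/-- ★★★ **C3 `Cumulant58` AT THE RECORD CONSTANTS FROM THE RE-CUT ROW `hloc58` AND THE (3.24) ROWS** ((24) p.262 ∕ (58)–(59) p.270): the (α) rows `hμ` (#1), `hboxm`∕`hbox` (#2–3), `hVm`∕`hVB`
(#4–5), `h324a` (#16), `h324c` (#17) and the UPPER (59)-localisation row `hloc58` (#14′, LQB `LocalizationUpper` at the lane's pieces) give `Cumulant58 (piecesAC 𝔠.lane X 𝔖 k) 𝔠.lane.sc.Cz 𝔠.lane.sc.C₁`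
— exactly the conclusion of ✓`AlphaAdaptersAC.cumulant58_piecesAC`, WITHOUT `Gt`∕`hact`∕`hG`∕(25). [cite: Balaban1985UV3, (24) p.262 + (58)–(59) p.270; Balaban1982Higgs1, (3.24) p.616] -/
theorem cumulant58_piecesAC_of_hloc58 (hμ : IsProbabilityMeasure (𝔖 k).μ) {Bv : ℝ}
    (hboxm : ∀ h, MeasurableSet ((𝔖 k).box h)) (hbox : ∀ h, (𝔖 k).μ ((𝔖 k).box h) ≠ 0)
    (hVm : ∀ h U, AEMeasurable ((𝔖 k).𝒱 h U) (𝔖 k).μ)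
    (hVB : ∀ h U, ∀ ω ∈ (𝔖 k).box h, |(𝔖 k).𝒱 h U ω| ≤ Bv)
    (h324a : ∀ h (U : GaugeField S.P (k + 1) G), |Real.log ((𝔖 k).μ.real ((𝔖 k).box h))| ≤
      𝔠.Ca * ((L : ℝ) ^ k * S.g0sq) ^ (3 + 𝔠.κ₀) * S.sites k)
    (h324c : ∀ h U, ∀ t ∈ Set.Icc (0 : ℝ) 1, |iteratedDeriv (𝔠.nbar + 1) (ProbabilityTheory.cgf ((𝔖 k).𝒱 h U)
      (chiMeasure (𝔖 k).μ (((𝔖 k).box h).indicator fun _ => (1 : ℝ)))) t| ≤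
        𝔠.Cc * ((𝔠.nbar + 1).factorial : ℝ) * ((L : ℝ) ^ k * S.g0sq) ^ (3 + 𝔠.κ₀) * S.sites k)
    (hloc58 : ∀ (h : Hist S.P (k + 1)) (U : GaugeField S.P (k + 1) G),
      ∑ n ∈ Finset.Icc 1 𝔠.nbar, (𝔖 k).cum h U n / (n ! : ℝ)
        ≤ (piecesAC 𝔠.lane X 𝔖 k).PprU h U + (𝔠.C25 * K₀ (4 * 2 ^ 3) (2 * 3)) * S.gk k * (piecesAC 𝔠.lane X 𝔖 k).Zvol h
          + (𝔠.C25 * K₀ (4 * 2 ^ 3) (2 * 3) * Real.exp (-𝔠.R₁)) * (piecesAC 𝔠.lane X 𝔖 k).rem) :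
    Cumulant58 (piecesAC 𝔠.lane X 𝔖 k) 𝔠.lane.sc.Cz 𝔠.lane.sc.C₁ := by
  haveI := hμ
  have hrem : ((L : ℝ) ^ k * S.g0sq) ^ (3 + 𝔠.κ₀) * S.sites k ≤ (piecesAC 𝔠.lane X 𝔖 k).rem := by
    rw [norm_rem_eq S 𝔠.κ₀ k]
    exact le_of_eq rfl
  intro (h : Hist S.P (k + 1)) (U : GaugeField S.P (k + 1) G)
  show (piecesAC 𝔠.lane X 𝔖 k).logFl h U ≤ (piecesAC 𝔠.lane X 𝔖 k).PprU h U
      + 𝔠.C25 * K₀ (4 * 2 ^ 3) (2 * 3) * S.gk k * (piecesAC 𝔠.lane X 𝔖 k).Zvol h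
      + (0 + 𝔠.C25 * K₀ (4 * 2 ^ 3) (2 * 3) * Real.exp (-𝔠.R₁) + (𝔠.Ca + 0 + 𝔠.Cc)) * (piecesAC 𝔠.lane X 𝔖 k).rem
  -- (58)-reading: `logFl = log ∫_{box} e^{𝒱} dμ` (rfl for the series pieces)
  have h1 : (piecesAC 𝔠.lane X 𝔖 k).logFl h U = Real.log (∫ ω in (𝔖 k).box h, Real.exp ((𝔖 k).𝒱 h U ω) ∂(𝔖 k).μ) := rfl
  -- (3.24) with the re-expansion input (b) vanishing (`cum := truncExp …`)
  have h324b : |∑ n ∈ Finset.Icc 1 𝔠.nbar, ((𝔖 k).cum h U n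
      - truncExp ((𝔖 k).𝒱 h U) (chiMeasure (𝔖 k).μ (((𝔖 k).box h).indicator fun _ => (1 : ℝ))) n) / (n ! : ℝ)|
        ≤ 0 * ((L : ℝ) ^ k * S.g0sq) ^ (3 + 𝔠.κ₀) * S.sites k := by
    simp [StepSeries.cum]
  have h324 := eq324_indicator_of_measurableSet (𝔖 k).μ (hboxm h) (hbox h) (hVm h U) (hVB h U) 𝔠.nbar ((𝔖 k).cum h U)
    (h324a h U) h324b (h324c h U)
  have h2 := (abs_le.1 (B1Eq324CumulantTaylor.abs_log_sub_le_of_eq324 h324)).2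
  have h3 := hloc58 h U
  have hC : 0 ≤ 𝔠.Ca + 0 + 𝔠.Cc := by have := 𝔠.Cac_nonneg; linarith
  have h4 : (𝔠.Ca + 0 + 𝔠.Cc) * ((L : ℝ) ^ k * S.g0sq) ^ (3 + 𝔠.κ₀) * S.sites k ≤ (𝔠.Ca + 0 + 𝔠.Cc) * (piecesAC 𝔠.lane X 𝔖 k).rem := by
    rw [mul_assoc]; exact mul_le_mul_of_nonneg_left hrem hC
  rw [h1]
  refine (sub_le_iff_le_add'.mp h2).trans ((add_le_add h3 h4).trans_eq ?_)
  ring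

/-! ## §2 C4 from `hlocLow` + the (3.24) rows -/

/-- ★★★ **C4 `CumulantLower` AT THE RECORD CONSTANT FROM THE RE-CUT ROW `hlocLow` AND THE (3.24) ROWS** ((37) p.265 ∕ p.272): same data, the LOWER (59)-localisation row `hlocLow` (#15′, LQB
`LocalizationLower`, trivial history) gives `CumulantLower (piecesAC 𝔠.lane X 𝔖 k) 𝔠.lane.sc.C₁'` — the conclusion of ✓`AlphaAdaptersAC.cumulantLower_piecesAC`, WITHOUT `Gt`∕`hact`∕`hG`∕(25).
[cite: Balaban1985UV3, (37) p.265 + p.272 + (59) p.270; Balaban1982Higgs1, (3.24) p.616] -/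
theorem cumulantLower_piecesAC_of_hlocLow (hμ : IsProbabilityMeasure (𝔖 k).μ) {Bv : ℝ}
    (hboxm : ∀ h, MeasurableSet ((𝔖 k).box h)) (hbox : ∀ h, (𝔖 k).μ ((𝔖 k).box h) ≠ 0)
    (hVm : ∀ h U, AEMeasurable ((𝔖 k).𝒱 h U) (𝔖 k).μ)
    (hVB : ∀ h U, ∀ ω ∈ (𝔖 k).box h, |(𝔖 k).𝒱 h U ω| ≤ Bv)
    (h324a : ∀ h (U : GaugeField S.P (k + 1) G), |Real.log ((𝔖 k).μ.real ((𝔖 k).box h))| ≤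
      𝔠.Ca * ((L : ℝ) ^ k * S.g0sq) ^ (3 + 𝔠.κ₀) * S.sites k)
    (h324c : ∀ h U, ∀ t ∈ Set.Icc (0 : ℝ) 1, |iteratedDeriv (𝔠.nbar + 1) (ProbabilityTheory.cgf ((𝔖 k).𝒱 h U)
      (chiMeasure (𝔖 k).μ (((𝔖 k).box h).indicator fun _ => (1 : ℝ)))) t| ≤
        𝔠.Cc * ((𝔠.nbar + 1).factorial : ℝ) * ((L : ℝ) ^ k * S.g0sq) ^ (3 + 𝔠.κ₀) * S.sites k)
    (hlocLow : ∀ U : GaugeField S.P (k + 1) G,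
      (piecesAC 𝔠.lane X 𝔖 k).PprU (Hist.triv S.P (k + 1)) U - (𝔠.C25 * K₀ (4 * 2 ^ 3) (2 * 3) * Real.exp (-𝔠.R₁)) * (piecesAC 𝔠.lane X 𝔖 k).rem
        ≤ ∑ n ∈ Finset.Icc 1 𝔠.nbar, (𝔖 k).cum (Hist.triv S.P (k + 1)) U n / (n ! : ℝ)) :
    CumulantLower (piecesAC 𝔠.lane X 𝔖 k) 𝔠.lane.sc.C₁' := by
  haveI := hμ
  have hrem : ((L : ℝ) ^ k * S.g0sq) ^ (3 + 𝔠.κ₀) * S.sites k ≤ (piecesAC 𝔠.lane X 𝔖 k).rem := by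
    rw [norm_rem_eq S 𝔠.κ₀ k]
    exact le_of_eq rfl
  intro (U : GaugeField S.P (k + 1) G)
  show (piecesAC 𝔠.lane X 𝔖 k).PprU (Hist.triv S.P (k + 1)) U
      - (0 + 𝔠.C25 * K₀ (4 * 2 ^ 3) (2 * 3) * Real.exp (-𝔠.R₁) + (𝔠.Ca + 0 + 𝔠.Cc)) * (piecesAC 𝔠.lane X 𝔖 k).rem
        ≤ (piecesAC 𝔠.lane X 𝔖 k).logFl (Hist.triv S.P (k + 1)) U
  have h1 : (piecesAC 𝔠.lane X 𝔖 k).logFl (Hist.triv S.P (k + 1)) U =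
      Real.log (∫ ω in (𝔖 k).box (Hist.triv S.P (k + 1)), Real.exp ((𝔖 k).𝒱 (Hist.triv S.P (k + 1)) U ω) ∂(𝔖 k).μ) := rfl
  have h324b : |∑ n ∈ Finset.Icc 1 𝔠.nbar, ((𝔖 k).cum (Hist.triv S.P (k + 1)) U n
      - truncExp ((𝔖 k).𝒱 (Hist.triv S.P (k + 1)) U)
          (chiMeasure (𝔖 k).μ (((𝔖 k).box (Hist.triv S.P (k + 1))).indicator fun _ => (1 : ℝ))) n) / (n ! : ℝ)|
        ≤ 0 * ((L : ℝ) ^ k * S.g0sq) ^ (3 + 𝔠.κ₀) * S.sites k := by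
    simp [StepSeries.cum]
  have h324 := eq324_indicator_of_measurableSet (𝔖 k).μ (hboxm _) (hbox _) (hVm (Hist.triv S.P (k + 1)) U) (hVB _ U) 𝔠.nbar
    ((𝔖 k).cum (Hist.triv S.P (k + 1)) U) (h324a _ U) h324b (h324c _ U)
  have h2 := (abs_le.1 (B1Eq324CumulantTaylor.abs_log_sub_le_of_eq324 h324)).1
  have h3 := hlocLow U
  have hC : 0 ≤ 𝔠.Ca + 0 + 𝔠.Cc := by have := 𝔠.Cac_nonneg; linarith
  have h4 : (𝔠.Ca + 0 + 𝔠.Cc) * ((L : ℝ) ^ k * S.g0sq) ^ (3 + 𝔠.κ₀) * S.sites k ≤ (𝔠.Ca + 0 + 𝔠.Cc) * (piecesAC 𝔠.lane X 𝔖 k).rem := by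
    rw [mul_assoc]; exact mul_le_mul_of_nonneg_left hrem hC
  rw [h1]
  have e1 := (sub_le_sub h3 h4).trans (sub_le_iff_le_add.mpr (neg_le_sub_iff_le_add.mp h2))
  refine (le_of_eq ?_).trans e1
  ring

/-! ## §3 The round trip (D→) ∘ (D←): today's rows #14 `hact` + #15 `hG` + (25) give back C3 ∕ C4 THROUGH the re-cut rows — the certificate that
the (R2′) re-cut `{hact, hG} ↦ {hloc58, hlocLow}` is SUFFICIENT for the lane (and, with ✓`AlphaV3Loc59RowsOfGraphPair`, loses nothing) -/

open Classical in
/-- ★★ **ROUND TRIP, UPPER**: rows #14 `hact` + #15 `hG` + (25) `h25` (today's C3 inputs at `𝔠.lane`, cf. ✓`AlphaAdaptersAC.cumulant58_piecesAC`) ⟹ via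
✓`hloc58_of_hact_hG` ((D→)) and `cumulant58_piecesAC_of_hloc58` ((D←)) ⟹ `Cumulant58 (piecesAC 𝔠.lane X 𝔖 k) 𝔠.lane.sc.Cz 𝔠.lane.sc.C₁` — C3's conclusion recovered
through the re-cut row alone. [cite: Balaban1985UV3, (24) p.262 + (58)–(59) p.270; Balaban1982Higgs1, (3.24) p.616] -/
theorem cumulant58_piecesAC_via_hloc58 (hk : k + 1 ≤ S.K) (hμ : IsProbabilityMeasure (𝔖 k).μ) {Bv C₂₃ c M₁ δ₀ : ℝ}
    (hact : ∀ h Y U, ((𝔖 k).Gt h).activities.act Y U = (𝔖 k).act h Y U)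
    (hboxm : ∀ h, MeasurableSet ((𝔖 k).box h)) (hbox : ∀ h, (𝔖 k).μ ((𝔖 k).box h) ≠ 0)
    (hVm : ∀ h U, AEMeasurable ((𝔖 k).𝒱 h U) (𝔖 k).μ)
    (hVB : ∀ h U, ∀ ω ∈ (𝔖 k).box h, |(𝔖 k).𝒱 h U ω| ≤ Bv)
    (h324a : ∀ h (U : GaugeField S.P (k + 1) G), |Real.log ((𝔖 k).μ.real ((𝔖 k).box h))| ≤
      𝔠.Ca * ((L : ℝ) ^ k * S.g0sq) ^ (3 + 𝔠.κ₀) * S.sites k)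
    (h324c : ∀ h U, ∀ t ∈ Set.Icc (0 : ℝ) 1, |iteratedDeriv (𝔠.nbar + 1) (ProbabilityTheory.cgf ((𝔖 k).𝒱 h U)
      (chiMeasure (𝔖 k).μ (((𝔖 k).box h).indicator fun _ => (1 : ℝ)))) t| ≤
        𝔠.Cc * ((𝔠.nbar + 1).factorial : ℝ) * ((L : ℝ) ^ k * S.g0sq) ^ (3 + 𝔠.κ₀) * S.sites k)
    (hG : ∀ h, GraphRep23AsCited ((𝔖 k).Gt h) (fun U => ∑ n ∈ Finset.Icc 1 𝔠.nbar, (𝔖 k).cum h U n / (n ! : ℝ)) C₂₃ c M₁ δ₀)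
    (h25 : ∀ h, Bound25Printed ⟨(tsys 3 (nblkOf S 𝔠.lane.carrier k)).Dom, GaugeField S.P (k + 1) G, (tsys 3 (nblkOf S 𝔠.lane.carrier k)).dj,
      (𝔖 k).act h⟩ (S.gk k) 𝔠.κ 𝔠.C25) :
    Cumulant58 (piecesAC 𝔠.lane X 𝔖 k) 𝔠.lane.sc.Cz 𝔠.lane.sc.C₁ :=
  cumulant58_piecesAC_of_hloc58 𝔊 𝔠 X 𝔖 k hμ hboxm hbox hVm hVB h324a h324c
    (AlphaV3Loc59RowsOfGraphPair.hloc58_of_hact_hG 𝔊 𝔠 X 𝔖 k hk hact hG h25)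

open Classical in
/-- ★★ **ROUND TRIP, LOWER**: the same data ⟹ via ✓`hlocLow_of_hact_hG` ((D→)) and `cumulantLower_piecesAC_of_hlocLow` ((D←)) ⟹
`CumulantLower (piecesAC 𝔠.lane X 𝔖 k) 𝔠.lane.sc.C₁'` — C4's conclusion (cf. ✓`AlphaAdaptersAC.cumulantLower_piecesAC`) through the re-cut row alone.
[cite: Balaban1985UV3, (37) p.265 + p.272 + (59) p.270; Balaban1982Higgs1, (3.24) p.616] -/
theorem cumulantLower_piecesAC_via_hlocLow (hk : k + 1 ≤ S.K) (hμ : IsProbabilityMeasure (𝔖 k).μ) {Bv C₂₃ c M₁ δ₀ : ℝ}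
    (hact : ∀ h Y U, ((𝔖 k).Gt h).activities.act Y U = (𝔖 k).act h Y U)
    (hboxm : ∀ h, MeasurableSet ((𝔖 k).box h)) (hbox : ∀ h, (𝔖 k).μ ((𝔖 k).box h) ≠ 0)
    (hVm : ∀ h U, AEMeasurable ((𝔖 k).𝒱 h U) (𝔖 k).μ)
    (hVB : ∀ h U, ∀ ω ∈ (𝔖 k).box h, |(𝔖 k).𝒱 h U ω| ≤ Bv)
    (h324a : ∀ h (U : GaugeField S.P (k + 1) G), |Real.log ((𝔖 k).μ.real ((𝔖 k).box h))| ≤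
      𝔠.Ca * ((L : ℝ) ^ k * S.g0sq) ^ (3 + 𝔠.κ₀) * S.sites k)
    (h324c : ∀ h U, ∀ t ∈ Set.Icc (0 : ℝ) 1, |iteratedDeriv (𝔠.nbar + 1) (ProbabilityTheory.cgf ((𝔖 k).𝒱 h U)
      (chiMeasure (𝔖 k).μ (((𝔖 k).box h).indicator fun _ => (1 : ℝ)))) t| ≤
        𝔠.Cc * ((𝔠.nbar + 1).factorial : ℝ) * ((L : ℝ) ^ k * S.g0sq) ^ (3 + 𝔠.κ₀) * S.sites k)
    (hG : ∀ h, GraphRep23AsCited ((𝔖 k).Gt h) (fun U => ∑ n ∈ Finset.Icc 1 𝔠.nbar, (𝔖 k).cum h U n / (n ! : ℝ)) C₂₃ c M₁ δ₀)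
    (h25 : ∀ h, Bound25Printed ⟨(tsys 3 (nblkOf S 𝔠.lane.carrier k)).Dom, GaugeField S.P (k + 1) G, (tsys 3 (nblkOf S 𝔠.lane.carrier k)).dj,
      (𝔖 k).act h⟩ (S.gk k) 𝔠.κ 𝔠.C25) :
    CumulantLower (piecesAC 𝔠.lane X 𝔖 k) 𝔠.lane.sc.C₁' :=
  cumulantLower_piecesAC_of_hlocLow 𝔊 𝔠 X 𝔖 k hμ hboxm hbox hVm hVB h324a h324c
    (AlphaV3Loc59RowsOfGraphPair.hlocLow_of_hact_hG 𝔊 𝔠 X 𝔖 k hk hact hG h25)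

end Summit.QuantumFields.YangMills.Theorems.AlphaV3CumulantLeavesOfLoc59Rows

end
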